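import Summits.CriticalPhenomena.PercolationContinuityZ3.Theorems.PercNearOneGluingNoHeavyLowerTailCubicThreePointSharpDichotomy
import Mathlib.Tactic.Ring
import Mathlib.Tactic.Linarith
import Mathlib.Tactic.Positivity
import HarnessLib

/-!
# `NoHeavyLowerTail` (stmt-CriticalPhenomena-4575) — the sharp cubic row `Hmax3` follows from TWO REGIME-FREE rows in apex-refined cells
# (the Γ / S4 split of the star–triangle dichotomy)

Support file (prover prim-ineq-gen-2 gen 3, new-inequality factory; `--supports stmt-CriticalPhenomena-4575`).  Pure algebra over a
commutative ring / `ℝ`; no measure theory, no named facts, no sorries.  Cell convention and the forms `AG = qt − e₂(u)`,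
`Ha = t·AG − e₃`, `Hb = q·AG − e₃`, `Hqt = (q+t)·AG − e₃` of `…CubicThreePointTerminalClosure` / `…SharpDichotomy`
(`CubicThreePointTerminal.*`, `CubicThreePointSharp.*`): `(q,u₁,u₂,u₃,t) = (P(a|b|c), P(ab|c), P(ac|b), P(bc|a), P(abc))` for three
terminals `a, b, c` of a finite weighted graph `G` (independent open edges `ω`, every weight in `(0,1]`, `G` = the support).

## The problem this addresses
The censused sharp cubic row (ttrl2 `shk3lambda`: 0 violations in 2.5·10⁸ exact evaluations; INEQ-CLAIMS `SF3-Hmax`) is the DISJUNCTION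
`Hmax3 := max(q,t)·AG − e₃ = max(Ha, Hb) ≥ 0`, i.e. `P(abc)² ≥ P(ab)P(ac)P(bc)  ∨  P(a|b|c)² ≥ ∏ᵢ P(i ∤ rest)` (`…SharpDichotomy`), exactly tight on
every (blob-)star (`Ha ≡ 0`) and every (blob-)triangle (`Hb ≡ 0`).  A disjunction of two cubic inequalities is out of reach of every linear
method tried in the factory (one-coordinate inductions, LP/switching certificates: `…CubicThreePointNoGo`, `…PairNoGo`, ttrl2 `sf3/SWITCH.md`).

## What is recorded here (memo run/shared/lean/prim/prim-ineq-gen-2/HMAX-SPLIT.md)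
Fix the APEX `a` and refine the two extreme cells by two further probabilities of percolation events:
* `n  = P( a~b~c  and  b ≁ c in ω ∖ a )`  — all three joined and every OPEN `b–c` path passes through `a` (`a` is an open cut vertex for `bc`);
* `n′ = P( a|b|c  and  V(C_a(ω)) separates b from c in G )` — all three separated and every `b–c` path of the GRAPH meets the open cluster of `a`.
On the bare star (arms `α, β, γ` at `a, b, c`) `n = 0`, `n′ = α(1−β)(1−γ)`; on the bare triangle (`p_ab = z, p_ac = y, p_bc = x`) `n′ = 0`,
`n = yz(1−x)`.  Consider the two polynomial ("regime-free") rows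
  `Γ  := AG − u₃·(n + n′) ≥ 0`                                  (degree 2: Gladkov's `AG ≥ 0` sharpened by the exact star/triangle defect),
  `S₄ := t·Ha + q·Hb − (t − q)·u₃·(t·n − q·n′) ≥ 0`             (degree 3),
both EQUALITIES on the whole star family and the whole triangle family (`Gam_star`, `Gam_triangle`, `S4_star`, `S4_triangle` below, by `ring`).
THEOREM (`Ha_or_Hb_of_gamma_s4`, `hmax3_of_gamma_s4`, `Hqt_of_gamma_s4`): for nonnegative `q, t, u₃, n, n′` with `AG ≥ 0` (Gladkov, tree
`prodBernoulli_threePoint_strongHarris`),  `Γ ≥ 0 ∧ S₄ ≥ 0 ⟹ Ha ≥ 0 ∨ Hb ≥ 0` (`⟺ Hmax3 ≥ 0 ⟹ H_{q+t} ≥ 0 ⟹ AG⁺ ⟹ SHK3⁺`).  Proof: with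
`D₂ := Ha − (t−q)u₃n`, `D₁ := Hb − (q−t)u₃n′` one has `D₂ − D₁ = (t−q)·Γ` (`D2_sub_D1`, from `Ha − Hb = (t−q)·AG`) and `S₄ = t·D₂ + q·D₁`
(`S4_eq`); if `t ≥ q` then `D₂ ≥ 0` (either `D₁ ≥ 0` and `D₂ = D₁ + (t−q)Γ`, or `D₁ < 0` and `t·D₂ ≥ −q·D₁ > 0`), whence `Ha = D₂ + (t−q)u₃n ≥ 0`
(`Ha_ge_of_dense`: in fact `Ha ≥ (t−q)·u₃·n`); dually `Hb ≥ (q−t)·u₃·n′ ≥ 0` if `q ≥ t` (`Hb_ge_of_sparse`).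
So the dichotomy is implied by two ORDINARY inequalities between probabilities of percolation events, each tight on both identity families —
the shape amenable to Gladkov-type coordinate induction and to Gladkov–Zimin two-copy (Γ) / three-copy (S₄) switching with patterns refined by
the two flags.  STATUS of Γ, S₄ (2026-08-19): CONJECTURED — 0 violations in this seat's exact-rational and float censuses (random weighted graphs
n ≤ 8, all three apexes; structured families: rings ± chords, windmill, K₅, K₃,₃, wheels, prisms, octahedron at seven densities; 60 rational
Θ-graphs; adversarial climbs), exhaustive census requested from ttrl2 (`hmax-split-gamma-s4`, requests.jsonl l.383).  Recorded false neighbours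
(so the hypotheses are not idle): `q·n ≥ u₁u₂` is false (dense `K₄`), `D₁ ≥ 0` and `D₂ ≥ 0` are each false in one regime,
`D₁ + D₂ ≥ 0` and `q·D₂ + t·D₁ ≥ 0` are false; of the symmetric combinations only `S₄ = t·D₂ + q·D₁` survives.
[cite: Gladkov2024StrongFKG, Cor. 4.2 (the quadratic form AG)]; [cite: GladkovZimin2024HK, §4–§5 (switching lemmas / two-copy LP)]
-/

namespace Summit.CriticalPhenomena.PercolationContinuityZ3.Theorems

namespace CubicThreePointApex

open CubicThreePointTerminal CubicThreePointSharp

variable {R : Type*} [CommRing R]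

/-! ### The two apex-refined rows and the two regime defects (any commutative ring) -/

/-- `Γ = AG − u₃·(n + n′)`: Gladkov's quadratic form minus the exact star defect `u₃n′` and triangle defect `u₃n`
(`n = P(abc ∧ b≁c in ω∖a)`, `n′ = P(a|b|c ∧ V(C_a) separates b,c)`).  Conjectured `≥ 0` on every weighted graph. [folklore] -/
def Gam (q u₁ u₂ u₃ t n n' : R) : R := AG q u₁ u₂ u₃ t - u₃ * (n + n')

/-- `S₄ = t·Ha + q·Hb − (t − q)·u₃·(t·n − q·n′)`.  Conjectured `≥ 0` on every weighted graph. [folklore] -/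
def S4 (q u₁ u₂ u₃ t n n' : R) : R :=
  t * Ha q u₁ u₂ u₃ t + q * Hb q u₁ u₂ u₃ t - (t - q) * u₃ * (t * n - q * n')

/-- Dense-regime defect `D₂ = Ha − (t − q)·u₃·n` (vanishes on stars and triangles). [folklore] -/
def D2 (q u₁ u₂ u₃ t n : R) : R := Ha q u₁ u₂ u₃ t - (t - q) * u₃ * n

/-- Sparse-regime defect `D₁ = Hb − (q − t)·u₃·n′` (vanishes on stars and triangles). [folklore] -/
def D1 (q u₁ u₂ u₃ t n' : R) : R := Hb q u₁ u₂ u₃ t - (q - t) * u₃ * n'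

/-- `D₂ − D₁ = (t − q)·Γ` (from `Ha − Hb = (t − q)·AG`). [folklore] -/
theorem D2_sub_D1 (q u₁ u₂ u₃ t n n' : R) :
    D2 q u₁ u₂ u₃ t n - D1 q u₁ u₂ u₃ t n' = (t - q) * Gam q u₁ u₂ u₃ t n n' := by
  simp only [D2, D1, Gam, Ha, Hb, AG]; ring

/-- `S₄ = t·D₂ + q·D₁`. [folklore] -/
theorem S4_eq (q u₁ u₂ u₃ t n n' : R) :
    S4 q u₁ u₂ u₃ t n n' = t * D2 q u₁ u₂ u₃ t n + q * D1 q u₁ u₂ u₃ t n' := by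
  simp only [S4, D2, D1]; ring

/-- Equivalently `S₄ = (q + t)·D₁ + t(t − q)·Γ`. [folklore] -/
theorem S4_eq' (q u₁ u₂ u₃ t n n' : R) :
    S4 q u₁ u₂ u₃ t n n' = (q + t) * D1 q u₁ u₂ u₃ t n' + t * (t - q) * Gam q u₁ u₂ u₃ t n n' := by
  simp only [S4, D1, Gam, Ha, Hb, AG]; ring

/-! ### Both rows are EQUALITIES on the two identity families -/

/-- STAR law (hub with arms `α, β, γ` to `a, b, c`; apex `a`): `n = 0`, `n′ = α(1−β)(1−γ)`, and `Γ = 0`. [folklore] -/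
theorem Gam_star (α β γ : R) :
    Gam (1 - (α * β + α * γ + β * γ) + 2 * (α * β * γ)) (α * β * (1 - γ)) (α * γ * (1 - β)) (β * γ * (1 - α))
      (α * β * γ) 0 (α * (1 - β) * (1 - γ)) = 0 := by
  simp only [Gam, AG]; ring

/-- STAR law: `S₄ = 0`. [folklore] -/
theorem S4_star (α β γ : R) :
    S4 (1 - (α * β + α * γ + β * γ) + 2 * (α * β * γ)) (α * β * (1 - γ)) (α * γ * (1 - β)) (β * γ * (1 - α))
      (α * β * γ) 0 (α * (1 - β) * (1 - γ)) = 0 := by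
  simp only [S4, Ha, Hb]; ring

/-- STAR law: the sparse defect vanishes, `Hb = (q − t)·u₃·n′` (the exact amount by which dense stars violate `Hb ≥ 0`). [folklore] -/
theorem D1_star (α β γ : R) :
    D1 (1 - (α * β + α * γ + β * γ) + 2 * (α * β * γ)) (α * β * (1 - γ)) (α * γ * (1 - β)) (β * γ * (1 - α))
      (α * β * γ) (α * (1 - β) * (1 - γ)) = 0 := by
  simp only [D1, Hb]; ring

/-- TRIANGLE law (`p_bc = x, p_ac = y, p_ab = z`; apex `a`): `n′ = 0`, `n = yz(1−x)`, and `Γ = 0`. [folklore] -/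
theorem Gam_triangle (x y z : R) :
    Gam ((1 - x) * (1 - y) * (1 - z)) (z * (1 - x) * (1 - y)) (y * (1 - x) * (1 - z)) (x * (1 - y) * (1 - z))
      (x * y + x * z + y * z - 2 * (x * y * z)) (y * z * (1 - x)) 0 = 0 := by
  simp only [Gam, AG]; ring

/-- TRIANGLE law: `S₄ = 0`. [folklore] -/
theorem S4_triangle (x y z : R) :
    S4 ((1 - x) * (1 - y) * (1 - z)) (z * (1 - x) * (1 - y)) (y * (1 - x) * (1 - z)) (x * (1 - y) * (1 - z))
      (x * y + x * z + y * z - 2 * (x * y * z)) (y * z * (1 - x)) 0 = 0 := by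
  simp only [S4, Ha, Hb]; ring

/-- TRIANGLE law: the dense defect vanishes, `Ha = (t − q)·u₃·n` (the exact amount by which sparse triangles violate `Ha ≥ 0`). [folklore] -/
theorem D2_triangle (x y z : R) :
    D2 ((1 - x) * (1 - y) * (1 - z)) (z * (1 - x) * (1 - y)) (y * (1 - x) * (1 - z)) (x * (1 - y) * (1 - z))
      (x * y + x * z + y * z - 2 * (x * y * z)) (y * z * (1 - x)) = 0 := by
  simp only [D2, Ha]; ring

/-! ### The reduction (real cells) -/

/-- **Dense regime.** If `0 ≤ q ≤ t`, `0 < t`, `Γ ≥ 0` and `S₄ ≥ 0`, then `Ha ≥ (t − q)·u₃·n`: the star-sheet inequality together with its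
exact triangle defect (so `Ha ≥ 0` as soon as `u₃, n ≥ 0`). [folklore] -/
theorem Ha_ge_of_dense {q u₁ u₂ u₃ t n n' : ℝ} (hq : 0 ≤ q) (hqt : q ≤ t) (ht : 0 < t)
    (hG : 0 ≤ Gam q u₁ u₂ u₃ t n n') (hS : 0 ≤ S4 q u₁ u₂ u₃ t n n') :
    (t - q) * u₃ * n ≤ Ha q u₁ u₂ u₃ t := by
  have e1 := D2_sub_D1 q u₁ u₂ u₃ t n n'
  have e2 := S4_eq q u₁ u₂ u₃ t n n'
  have hD2 : 0 ≤ D2 q u₁ u₂ u₃ t n := by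
    by_cases h1 : 0 ≤ D1 q u₁ u₂ u₃ t n'
    · have : 0 ≤ (t - q) * Gam q u₁ u₂ u₃ t n n' := mul_nonneg (by linarith) hG
      linarith
    · have h1' : D1 q u₁ u₂ u₃ t n' < 0 := not_le.mp h1
      have hqD : q * D1 q u₁ u₂ u₃ t n' ≤ 0 := mul_nonpos_of_nonneg_of_nonpos hq h1'.le
      have htD : 0 ≤ t * D2 q u₁ u₂ u₃ t n := by linarith
      exact nonneg_of_mul_nonneg_right (by linarith [htD]) ht
  have : D2 q u₁ u₂ u₃ t n = Ha q u₁ u₂ u₃ t - (t - q) * u₃ * n := rfl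
  linarith

/-- **Sparse regime.** If `0 ≤ t ≤ q`, `0 < q`, `Γ ≥ 0` and `S₄ ≥ 0`, then `Hb ≥ (q − t)·u₃·n′`: the triangle-sheet inequality together with
its exact star defect. [folklore] -/
theorem Hb_ge_of_sparse {q u₁ u₂ u₃ t n n' : ℝ} (ht : 0 ≤ t) (htq : t ≤ q) (hq : 0 < q)
    (hG : 0 ≤ Gam q u₁ u₂ u₃ t n n') (hS : 0 ≤ S4 q u₁ u₂ u₃ t n n') :
    (q - t) * u₃ * n' ≤ Hb q u₁ u₂ u₃ t := by
  have e1 := D2_sub_D1 q u₁ u₂ u₃ t n n'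
  have e2 := S4_eq q u₁ u₂ u₃ t n n'
  have hD1 : 0 ≤ D1 q u₁ u₂ u₃ t n' := by
    by_cases h2 : 0 ≤ D2 q u₁ u₂ u₃ t n
    · have : 0 ≤ (q - t) * Gam q u₁ u₂ u₃ t n n' := mul_nonneg (by linarith) hG
      linarith
    · have h2' : D2 q u₁ u₂ u₃ t n < 0 := not_le.mp h2
      have htD : t * D2 q u₁ u₂ u₃ t n ≤ 0 := mul_nonpos_of_nonneg_of_nonpos ht h2'.le
      have hqD : 0 ≤ q * D1 q u₁ u₂ u₃ t n' := by linarith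
      exact nonneg_of_mul_nonneg_right (by linarith [hqD]) hq
  have : D1 q u₁ u₂ u₃ t n' = Hb q u₁ u₂ u₃ t - (q - t) * u₃ * n' := rfl
  linarith

/-- **THE REDUCTION.** For nonnegative cells and refinements with `AG ≥ 0` (Gladkov), the two regime-free rows `Γ ≥ 0`, `S₄ ≥ 0` imply the
sharp dichotomy `Ha ≥ 0 ∨ Hb ≥ 0` (`P(abc)² ≥ P(ab)P(ac)P(bc)` or `P(a|b|c)² ≥ ∏ P(i ∤ rest)`). [folklore] -/
theorem Ha_or_Hb_of_gamma_s4 {q u₁ u₂ u₃ t n n' : ℝ} (hq : 0 ≤ q) (hu₁ : 0 ≤ u₁) (hu₂ : 0 ≤ u₂) (hu₃ : 0 ≤ u₃) (ht : 0 ≤ t)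
    (hn : 0 ≤ n) (hn' : 0 ≤ n') (hag : 0 ≤ AG q u₁ u₂ u₃ t)
    (hG : 0 ≤ Gam q u₁ u₂ u₃ t n n') (hS : 0 ≤ S4 q u₁ u₂ u₃ t n n') :
    0 ≤ Ha q u₁ u₂ u₃ t ∨ 0 ≤ Hb q u₁ u₂ u₃ t := by
  rcases le_total q t with hqt | htq
  · left
    rcases eq_or_lt_of_le ht with h0 | hpos
    · -- degenerate corner `q = t = 0`: `AG ≥ 0` forces `e₂ = 0`, hence `e₃ = 0` and `Ha = 0`
      have hq0 : q = 0 := le_antisymm (h0 ▸ hqt) hq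
      have hAG : AG q u₁ u₂ u₃ t = -(u₁ * u₂ + u₁ * u₃ + u₂ * u₃) := by simp only [AG]; rw [hq0, ← h0]; ring
      have h12 : u₁ * u₂ = 0 := by nlinarith [mul_nonneg hu₁ hu₂, mul_nonneg hu₁ hu₃, mul_nonneg hu₂ hu₃]
      have : Ha q u₁ u₂ u₃ t = 0 := by
        simp only [Ha]; rw [← h0]
        linear_combination (-u₃) * h12
      linarith
    · have h := Ha_ge_of_dense hq hqt hpos hG hS
      exact le_trans (mul_nonneg (mul_nonneg (by linarith) hu₃) hn) h
  · right
    rcases eq_or_lt_of_le hq with h0 | hpos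
    · have ht0 : t = 0 := le_antisymm (h0 ▸ htq) ht
      have h12 : u₁ * u₂ = 0 := by
        have hAG : AG q u₁ u₂ u₃ t = -(u₁ * u₂ + u₁ * u₃ + u₂ * u₃) := by simp only [AG]; rw [ht0, ← h0]; ring
        nlinarith [mul_nonneg hu₁ hu₂, mul_nonneg hu₁ hu₃, mul_nonneg hu₂ hu₃]
      have : Hb q u₁ u₂ u₃ t = 0 := by
        simp only [Hb]; rw [← h0]
        linear_combination (-u₃) * h12
      linarith
    · have h := Hb_ge_of_sparse ht htq hpos hG hS
      exact le_trans (mul_nonneg (mul_nonneg (by linarith) hu₃) hn') h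

/-- **THE REDUCTION, `Hmax3` form:** `Γ ≥ 0 ∧ S₄ ≥ 0 ⟹ max(q,t)·AG − e₃ ≥ 0` (the SF3-Hmax row). [folklore] -/
theorem hmax3_of_gamma_s4 {q u₁ u₂ u₃ t n n' : ℝ} (hq : 0 ≤ q) (hu₁ : 0 ≤ u₁) (hu₂ : 0 ≤ u₂) (hu₃ : 0 ≤ u₃) (ht : 0 ≤ t)
    (hn : 0 ≤ n) (hn' : 0 ≤ n') (hag : 0 ≤ AG q u₁ u₂ u₃ t)
    (hG : 0 ≤ Gam q u₁ u₂ u₃ t n n') (hS : 0 ≤ S4 q u₁ u₂ u₃ t n n') :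
    0 ≤ max q t * AG q u₁ u₂ u₃ t - u₁ * u₂ * u₃ := by
  rw [← max_Ha_Hb hag]
  rcases Ha_or_Hb_of_gamma_s4 hq hu₁ hu₂ hu₃ ht hn hn' hag hG hS with h | h
  · exact le_trans h (le_max_left _ _)
  · exact le_trans h (le_max_right _ _)

/-- **THE REDUCTION, `H_{q+t}` form:** `Γ ≥ 0 ∧ S₄ ≥ 0 ⟹ H_{q+t} = (q+t)·AG − e₃ ≥ 0` (hence AG⁺ and SHK3⁺ on the simplex, `…TerminalClosure`). [folklore] -/
theorem Hqt_of_gamma_s4 {q u₁ u₂ u₃ t n n' : ℝ} (hq : 0 ≤ q) (hu₁ : 0 ≤ u₁) (hu₂ : 0 ≤ u₂) (hu₃ : 0 ≤ u₃) (ht : 0 ≤ t)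
    (hn : 0 ≤ n) (hn' : 0 ≤ n') (hag : 0 ≤ AG q u₁ u₂ u₃ t)
    (hG : 0 ≤ Gam q u₁ u₂ u₃ t n n') (hS : 0 ≤ S4 q u₁ u₂ u₃ t n n') :
    0 ≤ Hqt q u₁ u₂ u₃ t := by
  have h := Hqt_ge_max hq ht hag
  rcases Ha_or_Hb_of_gamma_s4 hq hu₁ hu₂ hu₃ ht hn hn' hag hG hS with h' | h'
  · exact le_trans (le_trans h' (le_max_left _ _)) h
  · exact le_trans (le_trans h' (le_max_right _ _)) h

/-! ### UPDATE (same session, after ttrl2's exhaustive census `hms`, 2026-08-19): `S₄` (as stated, exponent 1) is FALSE; the regime pair and `Γ` stand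

ttrl2 (`run/shared/lean/ttrl/hms/README.md`, exact, all connected supports on `n ≤ 6` vertices × every apex/pair placement × 21 weight families =
155 988 evaluations): `Γ ≥ 0`: 0 violations; `C2`: 0; the REGIME statements `t ≥ q ⇒ D₂ ≥ 0` and `q ≥ t ⇒ D₁ ≥ 0`: 0; `Hmax3`: 0 — but the regime-free
merge `S₄ = t·D₂ + q·D₁ ≥ 0` FAILS on 24 instances (all in two-scale / per-edge `k/20` weight families; smallest below, on an outerplanar support where
`Hmax3` is even proved).  Consequently the theorems above remain valid and USEFUL only through their hypotheses `Γ`, `D₁`, `D₂`: the surviving route to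
`Hmax3` is `Γ ≥ 0` (regime-free, conjectured, inductive structure — memo HMAX-SPLIT.md §6) together with ONE of the two regime statements, or a
weighted merge `t^k·D₂ + q^k·D₁ ≥ 0` with an exponent `k` that ttrl2 is determining (the case analysis is identical for any positive weights:
`Ha_or_Hb_of_gamma_weighted`).  `S4_census_witness` records the exact refuting values. -/

/-- **ttrl2's refuting instance for `S₄` (exponent 1), as exact arithmetic.**  Support `C₅ = 4–0–1–2–3–4` plus chord `0–3`, weights
`w₀₁ = 1/5, w₀₃ = 1/20, w₀₄ = 19/20, w₁₂ = 11/20, w₂₃ = 9/10, w₃₄ = 1/10`, apex `a = 4`, `b = 1`, `c = 2`: the census reports the exact refined cells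
`(q,u₁,u₂,u₃,t,n,n′) = (635319/2000000, 148689/2000000, 186543/4000000, 777311/2000000, 690819/4000000, 29241/4000000, 0)` and `S₄ = −1.774·10⁻⁵ < 0`
(while `t < q`, `D₁ = Hb ≥ 0`, `Γ > 0`).  Recorded here only as the arithmetic fact at those rational values (realizability is the census's statement,
not formalized). [folklore] -/
theorem S4_census_witness :
    S4 (635319 / 2000000 : ℝ) (148689 / 2000000) (186543 / 4000000) (777311 / 2000000) (690819 / 4000000)
      (29241 / 4000000) 0 < 0 := by
  norm_num [S4, Ha, Hb]

/-- At the same rational values `Γ > 0` and `D₁ ≥ 0` with `t < q` — the regime statement holds where `S₄` fails. [folklore] -/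
theorem census_witness_regime :
    0 < Gam (635319 / 2000000 : ℝ) (148689 / 2000000) (186543 / 4000000) (777311 / 2000000) (690819 / 4000000)
      (29241 / 4000000) 0 ∧
    0 ≤ D1 (635319 / 2000000 : ℝ) (148689 / 2000000) (186543 / 4000000) (777311 / 2000000) (690819 / 4000000) 0 ∧
    (690819 / 4000000 : ℝ) < 635319 / 2000000 := by
  refine ⟨?_, ?_, ?_⟩
  · norm_num [Gam, AG]
  · norm_num [D1, Hb]
  · norm_num

/-- **The surviving reduction, regime form.**  The two REGIME statements (`t ≥ q ⇒ D₂ ≥ 0`, i.e. `Ha ≥ (t−q)u₃n`; `q ≥ t ⇒ D₁ ≥ 0`, i.e.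
`Hb ≥ (q−t)u₃n′`; both 0 violations in ttrl2's exhaustive `n ≤ 6` census and strictly stronger than the two halves of SF3-Hmax) give the dichotomy
for nonnegative `u₃, n, n′`. [folklore] -/
theorem Ha_or_Hb_of_regime_pair {q u₁ u₂ u₃ t n n' : ℝ} (hu₃ : 0 ≤ u₃) (hn : 0 ≤ n) (hn' : 0 ≤ n')
    (hD2 : q ≤ t → 0 ≤ D2 q u₁ u₂ u₃ t n) (hD1 : t ≤ q → 0 ≤ D1 q u₁ u₂ u₃ t n') :
    0 ≤ Ha q u₁ u₂ u₃ t ∨ 0 ≤ Hb q u₁ u₂ u₃ t := by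
  rcases le_total q t with hqt | htq
  · left
    have h := hD2 hqt
    have e : D2 q u₁ u₂ u₃ t n = Ha q u₁ u₂ u₃ t - (t - q) * u₃ * n := rfl
    nlinarith [mul_nonneg (mul_nonneg (sub_nonneg.mpr hqt) hu₃) hn]
  · right
    have h := hD1 htq
    have e : D1 q u₁ u₂ u₃ t n' = Hb q u₁ u₂ u₃ t - (q - t) * u₃ * n' := rfl
    nlinarith [mul_nonneg (mul_nonneg (sub_nonneg.mpr htq) hu₃) hn']

/-- **The surviving reduction, weighted regime-free form.**  For ANY positive weights `λ, μ` (e.g. `λ = t^k`, `μ = q^k`: the rows `S₄,ₖ` under census;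
`k = 1` is refuted), `Γ ≥ 0` and `λ·D₂ + μ·D₁ ≥ 0` imply the dichotomy: if `t ≥ q` then either `D₁ ≥ 0` and `D₂ = D₁ + (t−q)Γ ≥ 0`, or `D₁ < 0` and
`λD₂ ≥ −μD₁ > 0`; dually for `q ≥ t`. [folklore] -/
theorem Ha_or_Hb_of_gamma_weighted {q u₁ u₂ u₃ t n n' lam mu : ℝ} (hu₃ : 0 ≤ u₃) (hn : 0 ≤ n) (hn' : 0 ≤ n')
    (hlam : 0 < lam) (hmu : 0 < mu) (hG : 0 ≤ Gam q u₁ u₂ u₃ t n n')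
    (hS : 0 ≤ lam * D2 q u₁ u₂ u₃ t n + mu * D1 q u₁ u₂ u₃ t n') :
    0 ≤ Ha q u₁ u₂ u₃ t ∨ 0 ≤ Hb q u₁ u₂ u₃ t := by
  have e1 := D2_sub_D1 q u₁ u₂ u₃ t n n'
  apply Ha_or_Hb_of_regime_pair hu₃ hn hn'
  · intro hqt
    by_cases h1 : 0 ≤ D1 q u₁ u₂ u₃ t n'
    · have : 0 ≤ (t - q) * Gam q u₁ u₂ u₃ t n n' := mul_nonneg (sub_nonneg.mpr hqt) hG
      linarith
    · have h1' : D1 q u₁ u₂ u₃ t n' < 0 := not_le.mp h1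
      have : 0 < lam * D2 q u₁ u₂ u₃ t n := by nlinarith [mul_pos hmu (neg_pos.mpr h1')]
      exact (pos_of_mul_pos_right this hlam.le).le
  · intro htq
    by_cases h2 : 0 ≤ D2 q u₁ u₂ u₃ t n
    · have : 0 ≤ (q - t) * Gam q u₁ u₂ u₃ t n n' := mul_nonneg (sub_nonneg.mpr htq) hG
      linarith
    · have h2' : D2 q u₁ u₂ u₃ t n < 0 := not_le.mp h2
      have : 0 < mu * D1 q u₁ u₂ u₃ t n' := by nlinarith [mul_pos hlam (neg_pos.mpr h2')]
      exact (pos_of_mul_pos_right this hmu.le).le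

/-- The weighted rows with `λ = t^k`, `μ = q^k` (`S₄,ₖ := t^k·D₂ + q^k·D₁`; `k = 1` is the refuted `S₄`): for `q, t > 0`, `Γ ≥ 0 ∧ S₄,ₖ ≥ 0 ⟹ Hmax3 ≥ 0`.
[folklore] -/
theorem hmax3_of_gamma_s4k {q u₁ u₂ u₃ t n n' : ℝ} (k : ℕ) (hq : 0 < q) (ht : 0 < t) (hu₃ : 0 ≤ u₃) (hn : 0 ≤ n) (hn' : 0 ≤ n')
    (hag : 0 ≤ AG q u₁ u₂ u₃ t) (hG : 0 ≤ Gam q u₁ u₂ u₃ t n n')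
    (hS : 0 ≤ t ^ k * D2 q u₁ u₂ u₃ t n + q ^ k * D1 q u₁ u₂ u₃ t n') :
    0 ≤ max q t * AG q u₁ u₂ u₃ t - u₁ * u₂ * u₃ := by
  rw [← max_Ha_Hb hag]
  rcases Ha_or_Hb_of_gamma_weighted hu₃ hn hn' (pow_pos ht k) (pow_pos hq k) hG hS with h | h
  · exact le_trans h (le_max_left _ _)
  · exact le_trans h (le_max_right _ _)

end CubicThreePointApex

end Summit.CriticalPhenomena.PercolationContinuityZ3.Theorems
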